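import Mathlib
import HarnessLib
import Summits.QuantumFields.YangMills.Theorems.PencilRigidityCurvatureKernelBoundSwapHankelDecay

/-!
# `CurvatureKernelBound` — brick `SwapHankelDecayR` of lead c11's "radius `betaOne`" wave
# (crux stmt-QuantumFields-11687, line `coupling-trichotomy`, skeleton v11, brick R3)

**Exponential decay of the swap-Hankel sequence of the smeared curvature at a fixed lattice, with
the idle radius hypothesis relaxed from `β' < β₁/4` to `β' < β₁`.**
Spacing `a > 0`, box `Λ_L = {-L,…,L}⁴`, coupling `0 ≤ β ≤ β' < β₁`, pencil `v = e₀ - e₁`, mirror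
`θ = swap 0 1`; `q β`, `P β z` the infinite-volume one- and two-point data of the curvature `Q`
with clustering `|P β z - q β²| ≤ A e^{-m‖z‖_∞}` (a hypothesis here).  For `g` supported in
`{z₀ - z₁ ≥ δ}`, `a ≤ δ`, and `gθ = g ∘ θ`, the sequence
`E u = a⁸ ∑_{x,y ∈ Λ_L} g(a x) gθ(a y) (P β (y - x - 2u v) - q β²)` satisfies
`0 ≤ E u ≤ E 0 · e^{-2mu}` for all `u : ℕ`.
The proof is that of the brick `SwapHankelDecay` verbatim: the radius hypothesis is never used
there (reflection positivity across the swap mirror holds for every `β ≥ 0`, and clustering is a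
hypothesis), so the argument — `SwapReflectionPositivity` + `SmearedPositiveHalfSupport` feed
`SwapHankelLogConvex`, the far bound comes from clustering, and `LogConvexExpDecay` transports
the rate — goes through with `β' < β₁`.  All auxiliary lemmas are the public `SwapDecay.*`
lemmas of the imported brick. [folklore]
-/

noncomputable section

open scoped BigOperators Topology SchwartzMap
open MeasureTheory Filter Set
open Literature.MathematicalPhysics.QuantumLattice Literature.MathematicalPhysics.QuantumFieldTheory
  Literature.Probability.LatticeModels

namespace Summit.QuantumFields.YangMills.Theorems.CurvatureKernel

open SwapDecay in
/-- **Exponential decay of the swap-Hankel sequence of the smeared curvature (radius `β₁`).** At a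
fixed lattice (spacing `a > 0`, box `{-L,…,L}⁴`, coupling `0 ≤ β ≤ β' < β₁`), given the
infinite-volume one- and two-point data `q β`, `P β` of the curvature with exponential clustering
(hypothesis), a test function `g` supported in `{z₀ - z₁ ≥ δ}`, `a ≤ δ`, and its mirror image
`gθ = g ∘ swap 0 1`, the centred swap-Hankel sequence
`E u = a⁸ ∑_{x,y} g(a x) gθ(a y) (P β (y - x - 2u (e₀ - e₁)) - q β²)` is non-negative and
`E u ≤ E 0 · e^{-2mu}` for every `u` (reflection positivity ⇒ log-convexity, clustering ⇒ far
decay, `LogConvexExpDecay`); same proof as `SwapHankelDecay`, whose radius hypothesis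
`β' < β₁/4` is idle (REGISTERED signature — do not change). [folklore] -/
theorem SwapHankelDecayR : ∀ (G : Type) [Group G] [TopologicalSpace G] [IsTopologicalGroup G] [CompactSpace G] [T2Space G] [SecondCountableTopology G] [MeasurableSpace G] [BorelSpace G] (r : Literature.MathematicalPhysics.QuantumFieldTheory.LatticeRep G) (β' m A : ℝ) (q : ℝ → ℝ) (P : ℝ → Literature.Probability.LatticeModels.Site 4 → ℝ), 0 < β' → β' < betaOne 4 r.ρ → 0 < m → (∀ β : ℝ, 0 ≤ β → β ≤ β' → (∀ x : Literature.Probability.LatticeModels.Site 4, Literature.Probability.LatticeModels.HasBoxLimit (fun Λ => Literature.MathematicalPhysics.QuantumFieldTheory.zdExpect r.ρ β Λ (r.curvature.F ∘ Literature.MathematicalPhysics.QuantumFieldTheory.ZdGaugeConfig.translate x)) (q β)) ∧ (∀ x y : Literature.Probability.LatticeModels.Site 4, Literature.Probability.LatticeModels.HasBoxLimit (fun Λ => Literature.MathematicalPhysics.QuantumFieldTheory.zdExpect r.ρ β Λ (fun U => r.curvature.F (Literature.MathematicalPhysics.QuantumFieldTheory.ZdGaugeConfig.translate x U) * r.curvature.F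 (Literature.MathematicalPhysics.QuantumFieldTheory.ZdGaugeConfig.translate y U))) (P β (y - x))) ∧ ∀ z : Literature.Probability.LatticeModels.Site 4, |P β z - q β ^ 2| ≤ A * Real.exp (-(m * ‖z‖))) → ∀ (β : ℝ), 0 ≤ β → β ≤ β' → ∀ (L : ℕ) (a δ : ℝ), 0 < a → a ≤ δ → ∀ (g gθ : SchwartzMap (EuclideanSpace ℝ (Fin 4)) ℝ), (∀ z ∈ tsupport (g : EuclideanSpace ℝ (Fin 4) → ℝ), δ ≤ z 0 - z 1) → (∀ z : EuclideanSpace ℝ (Fin 4), gθ z = g (WithLp.toLp 2 (fun i => z (Equiv.swap (0 : Fin 4) 1 i)))) → ∀ u : ℕ, 0 ≤ a ^ 8 * ∑ x ∈ Literature.Probability.LatticeModels.box 4 L, ∑ y ∈ Literature.Probability.LatticeModels.box 4 L, g (a • Literature.MathematicalPhysics.QuantumLattice.siteToE x) * gθ (a • Literature.MathematicalPhysics.QuantumLattice.siteToE y) * (P β (y - x - ((2 * u : ℕ) : ℤ) • (Pi.single 0 (1 : ℤ) - Pi.single 1 (1 : ℤ) : Literature.Probability.LatticeModels.Site 4)) -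 q β ^ 2) ∧ a ^ 8 * ∑ x ∈ Literature.Probability.LatticeModels.box 4 L, ∑ y ∈ Literature.Probability.LatticeModels.box 4 L, g (a • Literature.MathematicalPhysics.QuantumLattice.siteToE x) * gθ (a • Literature.MathematicalPhysics.QuantumLattice.siteToE y) * (P β (y - x - ((2 * u : ℕ) : ℤ) • (Pi.single 0 (1 : ℤ) - Pi.single 1 (1 : ℤ) : Literature.Probability.LatticeModels.Site 4)) - q β ^ 2) ≤ (a ^ 8 * ∑ x ∈ Literature.Probability.LatticeModels.box 4 L, ∑ y ∈ Literature.Probability.LatticeModels.box 4 L, g (a • Literature.MathematicalPhysics.QuantumLattice.siteToE x) * gθ (a • Literature.MathematicalPhysics.QuantumLattice.siteToE y) * (P β (y - x) - q β ^ 2)) * Real.exp (-(2 * m * u)) := by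
  intro G _ _ _ _ _ _ _ _ r β' m A q P _ _ hm hF5 β hβ0 hββ' L a δ ha haδ g gθ hg hgθ
  obtain ⟨hq, hP, hclust⟩ := hF5 β hβ0 hββ'
  have hgθ' : ∀ y : Site 4, gθ (a • siteToE y) = g (a • siteToE (y ∘ ⇑(Equiv.swap (0 : Fin 4) 1))) :=
    swapTest_apply_smul_siteToE a g gθ hgθ
  have hA : 0 ≤ A :=
    nonneg_of_mul_nonneg_left ((abs_nonneg _).trans (hclust 0)) (Real.exp_pos _)
  -- the data fed into `SwapHankelLogConvex`
  have hRP := SwapReflectionPositivity r.ρ r.continuous r.mem_unitary (0 : Fin 4) 1 (by decide) β hβ0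
  obtain ⟨⟨BX, hBX, hXdep⟩, hXm, hXbd⟩ :=
    SmearedPositiveHalfSupport r (0 : Fin 4) 1 (by decide) L a δ ha haδ g hg
  obtain ⟨CQ, hCQ⟩ := r.curvature.bounded
  obtain ⟨PX, hPX⟩ : ∃ PX : ℕ → ℝ, ∀ t, PX t = a ^ 8 * ∑ x ∈ box 4 L, ∑ y ∈ box 4 L,
      g (a • siteToE x) * gθ (a • siteToE y) *
        P β (y - x - (t : ℤ) • (Pi.single 0 (1 : ℤ) - Pi.single 1 (1 : ℤ) : Site 4)) :=
    ⟨_, fun _ => rfl⟩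
  have key := SwapHankelLogConvex r.N G r.ρ 0 1 β hRP
    (smearedLatticeField r.curvature.F (box 4 L) a 1 0 g) hXm ⟨_, hXbd CQ hCQ⟩ BX hXdep hBX
    (a ^ 4 * ∑ x ∈ box 4 L, g (a • siteToE x) * q β) PX
    (fun n => hasBoxLimit_smeared_translate r β (q β) hq L a g _)
    (fun n => hasBoxLimit_smeared_swap_translate r β (q β) hq L a g gθ hgθ' _)
    (fun n n' => by
      have h := hasBoxLimit_smeared_pair r β (P β) (hP) L a g gθ hgθ'
        ((n : ℤ) • (Pi.single 0 (1 : ℤ) - Pi.single 1 (1 : ℤ) : Site 4))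
        (-((n' : ℤ) • (Pi.single 0 (1 : ℤ) - Pi.single 1 (1 : ℤ) : Site 4)))
      have hv : ∀ x y : Site 4,
          y + -((n' : ℤ) • (Pi.single 0 (1 : ℤ) - Pi.single 1 (1 : ℤ) : Site 4)) -
            (x + (n : ℤ) • (Pi.single 0 (1 : ℤ) - Pi.single 1 (1 : ℤ) : Site 4)) =
          y - x - ((n + n' : ℕ) : ℤ) • (Pi.single 0 (1 : ℤ) - Pi.single 1 (1 : ℤ) : Site 4) := by
        intro x y
        push_cast
        rw [add_smul]
        abel
      simp only [hv] at h
      rw [hPX]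
      exact h)
  obtain ⟨-, hnonneg, hlc⟩ := key
  -- centring identity `E u = PX (2u) - x̄²`
  have hE : ∀ u : ℕ, a ^ 8 * ∑ x ∈ box 4 L, ∑ y ∈ box 4 L, g (a • siteToE x) * gθ (a • siteToE y) *
      (P β (y - x - ((2 * u : ℕ) : ℤ) • (Pi.single 0 (1 : ℤ) - Pi.single 1 (1 : ℤ) : Site 4)) -
        q β ^ 2) = PX (2 * u) - (a ^ 4 * ∑ x ∈ box 4 L, g (a • siteToE x) * q β) ^ 2 := by
    intro u
    rw [hPX]
    exact centred_sum_eq a (q β) L g gθ hgθ' _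
  -- exponential decay from log-convexity and the far bound
  have hdecay := LogConvexExpDecay
    (fun u => PX (2 * u) - (a ^ 4 * ∑ x ∈ box 4 L, g (a • siteToE x) * q β) ^ 2)
    hnonneg hlc
    (a ^ 8 * (∑ x ∈ box 4 L, ∑ y ∈ box 4 L, |g (a • siteToE x)| * |gθ (a • siteToE y)|) *
      (A * Real.exp (2 * m * L))) (2 * m)
    (Frequently.of_forall fun U => by
      rw [← hE U]
      exact centred_sum_far_bound a (q β) A m ha hm hA L g gθ (P β) hclust U)
  intro u
  have h0 : a ^ 8 * ∑ x ∈ box 4 L, ∑ y ∈ box 4 L, g (a • siteToE x) * gθ (a • siteToE y) *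
      (P β (y - x) - q β ^ 2) = PX (2 * 0) - (a ^ 4 * ∑ x ∈ box 4 L, g (a • siteToE x) * q β) ^ 2 := by
    rw [← hE 0]
    simp
  rw [hE u, h0]
  exact ⟨hnonneg u, hdecay u⟩

end Summit.QuantumFields.YangMills.Theorems.CurvatureKernel

end
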